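import Mathlib.Analysis.InnerProductSpace.Basic
import Mathlib.LinearAlgebra.Eigenspace.Triangularizable
import Mathlib.Analysis.Complex.Polynomial.Basic
import Mathlib.LinearAlgebra.Matrix.ToLin
import Mathlib.LinearAlgebra.Matrix.ConjTranspose
import HarnessLib

/-!
# FLOOR-0 P2a (B4-archimedean desk), line 2 `F0_P2aCohIsotypicLine`, stub S2⁺ sub-lemma L2a — the datum-free
# `K`-SCHUR GRAM LEMMA

Cell hodgecm-mathlib (D-0151), FLOOR 0, crux item H413 = stmt-HodgeConjecture-24833; sub-line
`Cruxes/H413/Lines/F0_P2aCohIsotypicLine.lean` (sha16 fe64be0a9875628f), stub `stub_archOrth_hol : ArchOrthHolType` (S2⁺), sub-lemma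
**L2a** of the lead's cut (`F0/P2a/F0P2a-p01/CUT-S2plus.v1.md`, signature `sig_L2A`): «trace-orthogonality of the coordinate classes of two
holomorphic cotangent forms upgrades to orthogonality of ALL coordinate classes».  This file is its DATUM-FREE linear-algebra core
(desk ruling v3 (3b), author F0P2a-p04 (g0)); PROOF lane, theorems only, Mathlib-only imports.

## Content (all generic: any index type `K`, any finite index type `n`, any complex inner-product space `V`)
Let `R k : V → V` (`k : K`) preserve inner products, and let two families `u u' : n → V` transform under every `R k` through the SAME
matrix `B k` — `R k (u j) = ∑ i, B k j i • u i`, `R k (u' j) = ∑ i, B k j i • u' i` — with `B k` unitary (`(B k)ᴴ * B k = 1`) and the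
family `{B k}` IRREDUCIBLE on `ℂⁿ` (no `mulVec`-stable submodule other than `⊥`, `⊤`).  Then
* `gram_eq_mul_mul_conjTranspose`: the Gram matrix `X j j' := ⟪u' j', u j⟫` satisfies `X = B k * X * (B k)ᴴ`, hence
  `gram_mul_eq_mul_gram`: `X * B k = B k * X`;
* `exists_eq_smul_one_of_forall_mul_eq_mul` (Schur for an irreducible matrix family, `ℂ` algebraically closed): a matrix commuting with
  every `B k` is scalar;
* `exists_inner_eq_ite`: `⟪u j, u' j'⟫ = if j = j' then c else 0` for one constant `c`;
* `inner_eq_zero_of_sum_inner_eq_zero` (**the Gram lemma**): if moreover the TRACE `∑ j, ⟪u j, u' j⟫` vanishes, every `⟪u j, u' j'⟫ = 0`;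
* `irreducible_fin_two_of_wedge`: for `n = Fin 2`, irreducibility follows from «no stable line»: every `v ≠ 0` is moved off its line by
  some `B k` (`(B k *ᵥ v) 0 * v 1 - (B k *ᵥ v) 1 * v 0 ≠ 0`) — the shape of ★ `BallModel.exists_kU_wedge_ne_zero` / `BallModel.irred`.

## Use (the `sig_L2A` instance, not in this file)
For `Φ ∈ holCotForms … ι∞ Kc` the weight-form law ★ `weightForms` reads `Φ (x · ι∞ k) = τ k⁻¹ (Φ x)` with
`τ k⁻¹ = cotangentCocycle k x₀ = ((Jac k x₀)ᵀ *ᵥ ·)` (`k ∈ Stab x₀`), so the `L²` classes satisfy `R(ι∞ k) [Φ]ⱼ = ∑ᵢ (Jac k x₀)ᵀ j i • [Φ]ᵢ`: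
`B k = (Jac k x₀)ᵀ`, unitary at the stabiliser (★ `UnitBallIsotropyBlock.Jac_blockU_x₀`, `ulBlock_unitary_of_smul_x₀`), irreducible by
★ `UnitBallIsotropy.exists_kU_wedge_ne_zero`; `R k := rightRegular μ (ι∞ k)` preserves inner products (★ `norm_rightRegular_apply`).

HC_CM is proved only modulo the 7 printed citations until rung 0 closes; this file proves nothing about them.

## References
* [BorelWallach2000] A. Borel, N. Wallach, 2nd ed., AMS 2000, VII 3.2 (the `K`-type computation behind Matsushima's formula).
* [Bump1997] D. Bump, *Automorphic Forms and Representations*, CUP 1997, §2.4 (Schur orthogonality for compact groups) — the classical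
  statement «an intertwiner of an irreducible unitary representation is scalar» of which this is the Gram-matrix form.
* Tree: Mathlib `Module.End.exists_eigenvalue`, `Matrix.toLin'`, `inner_sum`, `sum_inner`; consumers ★ `Literature/Geometry/ComplexHyperbolic/
  UnitBallIsotropy(.Block)`, ★ `Literature/NumberTheory/Automorphic/WeightForms`.
-/

set_option autoImplicit false
set_option linter.dupNamespace false

noncomputable section

open scoped InnerProductSpace Matrix

namespace Summit.HodgeConjecture.HodgeConjecture.Cruxes.H413.F0P2aL2aKSchurGram

/-! ## §1 Invariance of the Gram matrix -/

section Gram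

variable {K : Type*} {n : Type*} [Fintype n] [DecidableEq n]
  {V : Type*} [NormedAddCommGroup V] [InnerProductSpace ℂ V]

omit [DecidableEq n] in
/-- **Invariance of the Gram matrix.**  If `R k` preserves inner products and `u, u'` transform under `R k` through the same matrix
`B k` (`R k (u j) = ∑ i, B k j i • u i`), then `X = B k * X * (B k)ᴴ` for the Gram matrix `X j j' = ⟪u' j', u j⟫`.
[cite: Bump1997, §2.4] -/
theorem gram_eq_mul_mul_conjTranspose (R : K → V → V) (hR : ∀ (k : K) (x y : V), ⟪R k x, R k y⟫_ℂ = ⟪x, y⟫_ℂ)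
    (B : K → Matrix n n ℂ) (u u' : n → V)
    (hu : ∀ (k : K) (j : n), R k (u j) = ∑ i, B k j i • u i) (hu' : ∀ (k : K) (j : n), R k (u' j) = ∑ i, B k j i • u' i)
    (k : K) :
    (Matrix.of fun j j' : n => ⟪u' j', u j⟫_ℂ) = B k * (Matrix.of fun j j' : n => ⟪u' j', u j⟫_ℂ) * (B k)ᴴ := by
  ext j j'
  have h : ⟪u' j', u j⟫_ℂ = ⟪R k (u' j'), R k (u j)⟫_ℂ := (hR k _ _).symm
  rw [Matrix.of_apply, h, hu, hu', sum_inner, Matrix.mul_apply]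
  refine Finset.sum_congr rfl fun i' _ => ?_
  rw [inner_smul_left, inner_sum, Matrix.conjTranspose_apply, Matrix.mul_apply, Finset.mul_sum, Finset.sum_mul]
  refine Finset.sum_congr rfl fun i _ => ?_
  rw [inner_smul_right, Matrix.of_apply, starRingEnd_apply]
  ring

/-- With `B k` unitary (`(B k)ᴴ * B k = 1`) the Gram matrix COMMUTES with `B k`: `X * B k = B k * X`. [cite: Bump1997, §2.4] -/
theorem gram_mul_eq_mul_gram (R : K → V → V) (hR : ∀ (k : K) (x y : V), ⟪R k x, R k y⟫_ℂ = ⟪x, y⟫_ℂ)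
    (B : K → Matrix n n ℂ) (hB : ∀ k, (B k)ᴴ * B k = 1) (u u' : n → V)
    (hu : ∀ (k : K) (j : n), R k (u j) = ∑ i, B k j i • u i) (hu' : ∀ (k : K) (j : n), R k (u' j) = ∑ i, B k j i • u' i)
    (k : K) :
    (Matrix.of fun j j' : n => ⟪u' j', u j⟫_ℂ) * B k = B k * (Matrix.of fun j j' : n => ⟪u' j', u j⟫_ℂ) := by
  conv_lhs => rw [gram_eq_mul_mul_conjTranspose R hR B u u' hu hu' k]
  rw [Matrix.mul_assoc, hB, Matrix.mul_one]

end Gram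

/-! ## §2 Schur's lemma for an irreducible family of matrices -/

section Schur

variable {K : Type*} {n : Type*} [Fintype n] [DecidableEq n]

/-- **Schur for an irreducible matrix family over `ℂ`.**  If no submodule of `ℂⁿ` other than `⊥`, `⊤` is stable under every
`B k *ᵥ ·`, then a matrix `X` commuting with every `B k` is scalar: an eigenspace of `X` (Mathlib `Module.End.exists_eigenvalue`,
`ℂ` algebraically closed) is a non-zero stable submodule. [cite: Bump1997, §2.4] -/
theorem exists_eq_smul_one_of_forall_mul_eq_mul (B : K → Matrix n n ℂ)
    (hirr : ∀ W : Submodule ℂ (n → ℂ), (∀ k, ∀ v ∈ W, B k *ᵥ v ∈ W) → W = ⊥ ∨ W = ⊤)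
    (X : Matrix n n ℂ) (hX : ∀ k, X * B k = B k * X) : ∃ c : ℂ, X = c • (1 : Matrix n n ℂ) := by
  rcases isEmpty_or_nonempty n with hn | hn
  · exact ⟨0, Subsingleton.elim _ _⟩
  obtain ⟨c, hc⟩ := Module.End.exists_eigenvalue (Matrix.toLin' X)
  refine ⟨c, ?_⟩
  have hstab : ∀ k, ∀ v ∈ Module.End.eigenspace (Matrix.toLin' X) c, B k *ᵥ v ∈ Module.End.eigenspace (Matrix.toLin' X) c := by
    intro k v hv
    rw [Module.End.mem_eigenspace_iff, Matrix.toLin'_apply] at hv ⊢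
    rw [Matrix.mulVec_mulVec, hX k, ← Matrix.mulVec_mulVec, hv, Matrix.mulVec_smul]
  rcases hirr _ hstab with h | h
  · exact absurd h hc
  · apply Matrix.toLin'.injective
    rw [LinearEquiv.map_smul, Matrix.toLin'_one]
    refine LinearMap.ext fun v => ?_
    have hv : v ∈ Module.End.eigenspace (Matrix.toLin' X) c := h ▸ Submodule.mem_top
    rw [Module.End.mem_eigenspace_iff] at hv
    rw [hv, LinearMap.smul_apply, LinearMap.id_apply]

/-- **Irreducibility on `ℂ²` from «no stable line».**  If every non-zero `v : Fin 2 → ℂ` is moved off its line by some `B k`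
(`(B k *ᵥ v) 0 * v 1 - (B k *ᵥ v) 1 * v 0 ≠ 0`, the `wedge` of ★ `BallModel.exists_kU_wedge_ne_zero`), then `⊥` and `⊤` are the only
`B`-stable submodules of `ℂ²`. [cite: Bump1997, §2.4] -/
theorem irreducible_fin_two_of_wedge (B : K → Matrix (Fin 2) (Fin 2) ℂ)
    (h : ∀ v : Fin 2 → ℂ, v ≠ 0 → ∃ k, (B k *ᵥ v) 0 * v 1 - (B k *ᵥ v) 1 * v 0 ≠ 0) :
    ∀ W : Submodule ℂ (Fin 2 → ℂ), (∀ k, ∀ v ∈ W, B k *ᵥ v ∈ W) → W = ⊥ ∨ W = ⊤ := by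
  intro W hW
  by_cases hbot : W = ⊥
  · exact Or.inl hbot
  right
  obtain ⟨v, hvW, hv⟩ := Submodule.exists_mem_ne_zero_of_ne_bot hbot
  obtain ⟨k, hk⟩ := h v hv
  set w : Fin 2 → ℂ := B k *ᵥ v with hw_def
  have hwW : w ∈ W := hW k v hvW
  set D : ℂ := w 0 * v 1 - w 1 * v 0 with hD
  refine Submodule.eq_top_iff'.mpr fun x => ?_
  have hx : x = (D⁻¹ * (x 1 * w 0 - x 0 * w 1)) • v + (D⁻¹ * (v 1 * x 0 - v 0 * x 1)) • w := by
    funext i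
    fin_cases i
    · simp only [Fin.zero_eta, Pi.add_apply, Pi.smul_apply, smul_eq_mul]
      field_simp
      ring
    · simp only [Fin.mk_one, Pi.add_apply, Pi.smul_apply, smul_eq_mul]
      field_simp
      ring
  rw [hx]
  exact W.add_mem (W.smul_mem _ hvW) (W.smul_mem _ hwW)

end Schur

/-! ## §3 The Gram lemma -/

section GramLemma

variable {K : Type*} {n : Type*} [Fintype n] [DecidableEq n]
  {V : Type*} [NormedAddCommGroup V] [InnerProductSpace ℂ V]

/-- **Scalar Gram matrix.**  Under the hypotheses of the module docstring (`R k` inner-product preserving, `u, u'` transforming through the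
same unitary irreducible matrix family `B`), `⟪u j, u' j'⟫ = if j = j' then c else 0` for one constant `c`. [cite: Bump1997, §2.4]
[cite: BorelWallach2000, VII 3.2] -/
theorem exists_inner_eq_ite (R : K → V → V) (hR : ∀ (k : K) (x y : V), ⟪R k x, R k y⟫_ℂ = ⟪x, y⟫_ℂ)
    (B : K → Matrix n n ℂ) (hB : ∀ k, (B k)ᴴ * B k = 1)
    (hirr : ∀ W : Submodule ℂ (n → ℂ), (∀ k, ∀ v ∈ W, B k *ᵥ v ∈ W) → W = ⊥ ∨ W = ⊤)
    (u u' : n → V)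
    (hu : ∀ (k : K) (j : n), R k (u j) = ∑ i, B k j i • u i) (hu' : ∀ (k : K) (j : n), R k (u' j) = ∑ i, B k j i • u' i) :
    ∃ c : ℂ, ∀ j j' : n, ⟪u j, u' j'⟫_ℂ = if j = j' then c else 0 := by
  obtain ⟨c, hc⟩ := exists_eq_smul_one_of_forall_mul_eq_mul B hirr (Matrix.of fun j j' : n => ⟪u' j', u j⟫_ℂ)
    (gram_mul_eq_mul_gram R hR B hB u u' hu hu')
  refine ⟨starRingEnd ℂ c, fun j j' => ?_⟩
  have h : ⟪u' j', u j⟫_ℂ = (c • (1 : Matrix n n ℂ)) j j' := by rw [← hc, Matrix.of_apply]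
  rw [← inner_conj_symm, h, Matrix.smul_apply, Matrix.one_apply, smul_eq_mul, mul_ite, mul_one, mul_zero]
  split_ifs <;> simp

/-- **The `K`-Schur Gram lemma (L2a, datum-free).**  If in addition the trace `∑ j, ⟪u j, u' j⟫` vanishes, then EVERY `⟪u j, u' j'⟫`
vanishes. [cite: BorelWallach2000, VII 3.2] [cite: Bump1997, §2.4] -/
theorem inner_eq_zero_of_sum_inner_eq_zero (R : K → V → V) (hR : ∀ (k : K) (x y : V), ⟪R k x, R k y⟫_ℂ = ⟪x, y⟫_ℂ)
    (B : K → Matrix n n ℂ) (hB : ∀ k, (B k)ᴴ * B k = 1)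
    (hirr : ∀ W : Submodule ℂ (n → ℂ), (∀ k, ∀ v ∈ W, B k *ᵥ v ∈ W) → W = ⊥ ∨ W = ⊤)
    (u u' : n → V)
    (hu : ∀ (k : K) (j : n), R k (u j) = ∑ i, B k j i • u i) (hu' : ∀ (k : K) (j : n), R k (u' j) = ∑ i, B k j i • u' i)
    (htr : ∑ j, ⟪u j, u' j⟫_ℂ = 0) :
    ∀ j j' : n, ⟪u j, u' j'⟫_ℂ = 0 := by
  obtain ⟨c, hc⟩ := exists_inner_eq_ite R hR B hB hirr u u' hu hu'
  have hsum : ∑ j : n, ⟪u j, u' j⟫_ℂ = Fintype.card n * c := by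
    rw [Finset.sum_congr rfl fun j _ => hc j j]
    simp only [if_true, Finset.sum_const, Finset.card_univ, nsmul_eq_mul]
  intro j j'
  rw [hc j j']
  split_ifs with hjj
  · rw [hsum] at htr
    rcases mul_eq_zero.mp htr with h0 | h0
    · haveI : Nonempty n := ⟨j⟩
      exact absurd (Nat.cast_eq_zero.mp h0) Fintype.card_ne_zero
    · exact h0
  · rfl

end GramLemma

end Summit.HodgeConjecture.HodgeConjecture.Cruxes.H413.F0P2aL2aKSchurGram

end
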